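import Summits.Ventures.YMGap.RobustBall.StateDerivativeOnBallS
import Summits.Ventures.YMGap.RobustBall.OneStateInvariant
import HarnessLib

/-!
# Venture YMGap, track ROBUST-BALL (Y2) — TIER 2: THE STATE IS `C¹` IN THE COUPLING, UNIFORMLY ON THE WEIGHTED BALL —
# `d/dβ ⟨F⟩ = −Σ_p cov(F, N − Re tr U_p)` for every member, every `N`, every `d`, directly in infinite volume

HONEST FRAMING. WHAT THIS IS: a venture file (cell `pub-ymgap`, track Y2 ROBUST-BALL, seat rb-p1): the COUPLING DIRECTION of the ball.  The Wilson
part of the tier-2 energy `−β S_Λ − Σ'_{X∩Λ≠∅} W_X` (`S_Λ = Σ_{p touching Λ} (N − Re tr U_p)`) is itself a range-1 link potential, the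
WILSON DIRECTION `wilsonDirection`: `X ↦ (N − Re tr U_p)` on the link set of a plaquette `p`, `0` elsewhere.  Hence
* `perturbedYMS_add_smul_wilsonDirection` — SHIFTING THE COUPLING IS MOVING ALONG A DIRECTION OF THE BALL:
  `perturbedYMS ρ β (W + s·wilsonDirection) = perturbedYMS ρ (β + s) W` (exact identity of specifications);
* `memBallZd_wilsonDirection` / `memBallZdS_wilsonDirection` — the direction is a member: tier-1 loads `(4(d−1)N, 8(d−1)√N)` at range `1`,
  tier-2 loads `(4(d−1)N, e^{t}·8(d−1)√N)` at every weight `t ≥ 0`; Lipschitz witnesses `√N·𝟙[y ∈ p]`, total Lipschitz load `≤ 8(d−1)√N`;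
* ★ `hasDerivAt_integral_coupling_S` — for `W ∈ MemBallZdS a Λ t` and the pair door at `(a + s₀·4(d−1)N, Λ + s₀·e^{t}8(d−1)√N, t)`: for EVERY
  selection `ν(s) ∈ 𝒢(perturbedYMS (β + s) W)` on `|s| ≤ s₀` and every bounded local Lipschitz `F`, `s ↦ ∫ F dν(s)` has derivative
  `−Σ'_X cov_{ν(s)}(F, wilsonDirection_X) = −Σ_p cov_{ν(s)}(F, N − Re tr U_p)` at every `|s| < s₀` and is `ContDiffOn ℝ 1` there — THE STATE OF
  EVERY MEMBER OF THE BALL IS `C¹` IN THE COUPLING with the fluctuation–response formula (`StateDerivativeOnBallS` in the Wilson direction);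
* `su2_hasDerivAt_integral_coupling_dim4` — `SU(2)`, `ℤ⁴`, hypothesis-free, in the cell's units (bare coupling `β_W/2`, direction `½·wilsonDirection`):
  `6|β_W| e^{a'} e^{t} + e^{a'/2} √(2/3) Λ' < 1`, `a + 12 s₀ ≤ a'`, `Λ + 12√2 e^{t} s₀ ≤ Λ'` ⇒ `β'_W ↦ ⟨F⟩_{β'_W, W}` is `C¹` on `|β'_W − β_W| < s₀`.
WHAT THIS IS NOT: ds-1's `CouplingDerivative.lean` (the Wilson point, `SU(2)`, `d = 4`, window `(0, 9/25)` via torus limits) has the better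
window at `W = 0`; here the point is uniformity over the ball and over `N, d`; `C¹` (not analytic); one-sided comparison constants; lattice
strong coupling only; nothing about the continuum limit or a Clay-sense mass gap.
-/

noncomputable section

open MeasureTheory Function Finset ProbabilityTheory Real Filter Topology
open scoped NNReal
open Literature.Probability.LatticeModels
open Literature.Probability.LatticeModels.DobrushinMetric
open Literature.MathematicalPhysics.QuantumLattice
open Literature.MathematicalPhysics.QuantumFieldTheory hiding ZdEdge
open Summit.QuantumFields.BalabanUV.InfraRed.StrongCouplingPoincareDoorSUN (oneLinkPoincareSUN_two_sharp)

namespace Summit.Ventures.YMGap.RobustBall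

variable {d N : ℕ}

/-! ### The Wilson direction -/

open Classical in
/-- **The Wilson direction**: on the link set of a plaquette `p` the term `N − Re tr U_p` (the summand of the tree's `wilsonBoundaryAction`),
`0` on every other link set (the plaquette with a given link set is unique, `plaquetteEdges_injective`, and recovered by choice). -/
def wilsonDirection : Potential (ZdEdge d) (Matrix.specialUnitaryGroup (Fin N) ℂ) := fun X U =>
  if h : ∃ p : ZdPlaquette d, plaquetteEdges p = X then
    (N : ℝ) - plaquetteObs (fundamentalRep (Fin N)) (Classical.choose h).1 (Classical.choose h).2.1.1 (Classical.choose h).2.1.2 U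
  else 0

/-- The term of a link set that is not a plaquette vanishes. -/
theorem wilsonDirection_of_not {X : Finset (ZdEdge d)} (h : ¬ ∃ p : ZdPlaquette d, plaquetteEdges p = X) :
    wilsonDirection (d := d) (N := N) X = fun _ => 0 := by
  funext U; simp [wilsonDirection, h]

/-- The term of the link set of the plaquette `p` is `N − Re tr U_p`. -/
theorem wilsonDirection_plaquetteEdges (p : ZdPlaquette d) (U : LGConfig d (Matrix.specialUnitaryGroup (Fin N) ℂ)) :
    wilsonDirection (N := N) (plaquetteEdges p) U = (N : ℝ) - plaquetteObs (fundamentalRep (Fin N)) p.1 p.2.1.1 p.2.1.2 U := by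
  have h : ∃ q : ZdPlaquette d, plaquetteEdges q = plaquetteEdges p := ⟨p, rfl⟩
  have hq : Classical.choose h = p := plaquetteEdges_injective (Classical.choose_spec h)
  simp only [wilsonDirection, dif_pos h, hq]

/-- Every term is continuous. -/
theorem continuous_wilsonDirection (X : Finset (ZdEdge d)) : Continuous (wilsonDirection (d := d) (N := N) X) := by
  unfold wilsonDirection
  split_ifs with h
  · exact continuous_const.sub (continuous_plaquetteObs _ (continuous_fundamentalRep (Fin N)) _ _ _)
  · exact continuous_const

/-- Every term depends only on its own link set. -/
theorem dependsOn_wilsonDirection (X : Finset (ZdEdge d)) : DependsOn (wilsonDirection (d := d) (N := N) X) (↑X : Set (ZdEdge d)) := by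
  intro U V hUV
  unfold wilsonDirection
  split_ifs with h
  · have hp := Classical.choose_spec h
    rw [isCylinder_plaquetteObs (fundamentalRep (Fin N)) (Classical.choose h) fun e he => hUV e (by rw [← hp]; exact he)]
  · rfl

/-- Every term is bounded by `2N`. -/
theorem abs_wilsonDirection_le (X : Finset (ZdEdge d)) (U : LGConfig d (Matrix.specialUnitaryGroup (Fin N) ℂ)) :
    |wilsonDirection (N := N) X U| ≤ 2 * N := by
  unfold wilsonDirection
  split_ifs with h
  · have hb := abs_plaquetteObs_le_holds (fundamentalRep (Fin N)) fundamentalRep_mem_unitaryGroup (Classical.choose h).1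
      (Classical.choose h).2.1.1 (Classical.choose h).2.1.2 U
    have hN : (0 : ℝ) ≤ N := Nat.cast_nonneg _
    rw [abs_le] at hb ⊢
    constructor <;> linarith [hb.1, hb.2]
  · simp

/-- The direction is supported by the plaquette family. -/
theorem isSupportedBy_wilsonDirection : (wilsonDirection (d := d) (N := N)).IsSupportedBy plaquetteSupp := by
  intro Λ A hA hne
  by_cases h : ∃ p : ZdPlaquette d, plaquetteEdges p = A
  · obtain ⟨p, hp⟩ := h
    refine Finset.mem_image.2 ⟨p, mem_plaquettesTouching_iff.2 ?_, hp⟩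
    rwa [hp]
  · exact (hne (wilsonDirection_of_not h)).elim

/-- Oscillation witnesses: `2N` on every link of a plaquette set, i.e. `2N` always suffices. -/
theorem isOscBound_wilsonDirection (X : Finset (ZdEdge d)) : Dobrushin.IsOscBound (wilsonDirection (d := d) (N := N) X) fun _ => 2 * N := by
  refine ⟨fun _ => by positivity, fun y U V _ => ?_⟩
  unfold wilsonDirection
  split_ifs with h
  · set p := Classical.choose h
    have ha := abs_plaquetteObs_le_holds (fundamentalRep (Fin N)) fundamentalRep_mem_unitaryGroup p.1 p.2.1.1 p.2.1.2 U
    have hb := abs_plaquetteObs_le_holds (fundamentalRep (Fin N)) fundamentalRep_mem_unitaryGroup p.1 p.2.1.1 p.2.1.2 V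
    rw [abs_le] at ha hb ⊢
    constructor <;> linarith [ha.1, ha.2, hb.1, hb.2]
  · simp

/-- Lipschitz witnesses: `√N` in each of its own links, `0` elsewhere. -/
theorem isLipBound_wilsonDirection (X : Finset (ZdEdge d)) :
    IsLipBound suFrobDist (wilsonDirection (d := d) (N := N) X) fun y => if y ∈ X then Real.sqrt N else 0 := by
  classical
  refine ⟨fun y => by split_ifs <;> positivity, fun y U V hUV => ?_⟩
  by_cases hyX : y ∈ X
  · rw [if_pos hyX]
    unfold wilsonDirection
    split_ifs with h
    · have hp := Classical.choose_spec h
      have hyp : y ∈ plaquetteEdges (Classical.choose h) := by rw [hp]; exact hyX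
      rw [show ∀ a b : ℝ, (N : ℝ) - a - ((N : ℝ) - b) = b - a from fun a b => by ring, abs_sub_comm]
      exact abs_plaquetteObs_sub_le_of_eq_off hyp hUV
    · rw [sub_self, abs_zero]; exact mul_nonneg (Real.sqrt_nonneg _) (suFrobDist_nonneg _ _)
  · rw [if_neg hyX, zero_mul]
    have heq := dependsOn_wilsonDirection (N := N) X (fun e he => hUV e fun h => hyX (h ▸ Finset.mem_coe.1 he))
    rw [heq, sub_self, abs_zero]

/-- **The Wilson direction is a member of the tier-1 ball** `MemBallZd (4(d−1)N) (8(d−1)√N) 1`. -/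
theorem memBallZd_wilsonDirection (hd : 1 ≤ d) :
    MemBallZd (4 * ((d : ℝ) - 1) * N) (8 * ((d : ℝ) - 1) * Real.sqrt N) 1 (wilsonDirection (d := d) (N := N)) plaquetteSupp := by
  classical
  have hcard : ∀ e : ZdEdge d, ((((plaquetteSupp {e}).filter fun X => e ∈ X).card : ℕ) : ℝ) ≤ 2 * ((d : ℝ) - 1) := fun e => by
    calc ((((plaquetteSupp {e}).filter fun X => e ∈ X).card : ℕ) : ℝ) ≤ ((2 * (d - 1) : ℕ) : ℝ) := by
          exact_mod_cast card_plaquetteSupp_singleton_le (d := d) e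
      _ = 2 * ((d : ℝ) - 1) := by push_cast [Nat.cast_sub hd]; ring
  refine ⟨continuous_wilsonDirection, dependsOn_wilsonDirection, isSupportedBy_wilsonDirection, range_adjointWitness,
    fun _ _ => 2 * N, fun X y => if y ∈ X then Real.sqrt N else 0, isOscBound_wilsonDirection, isLipBound_wilsonDirection,
    fun e => ?_, fun e => ?_⟩
  · rw [Finset.sum_const, nsmul_eq_mul]
    calc ((((plaquetteSupp {e}).filter fun X => e ∈ X).card : ℕ) : ℝ) * (2 * N) ≤ 2 * ((d : ℝ) - 1) * (2 * N) :=
          mul_le_mul_of_nonneg_right (hcard e) (by positivity)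
      _ = 4 * ((d : ℝ) - 1) * N := by ring
  · rw [Finset.sum_comm]
    have hX : ∀ X ∈ (plaquetteSupp {e}).filter (fun X => e ∈ X),
        ∑ y ∈ perturbedNbr plaquetteSupp e, (if y ∈ X then Real.sqrt N else 0) ≤ 4 * Real.sqrt N := by
      intro X hXm
      obtain ⟨p, -, hp⟩ := Finset.mem_image.1 (Finset.mem_filter.1 hXm).1
      rw [← Finset.sum_filter, Finset.sum_const, nsmul_eq_mul]
      refine mul_le_mul_of_nonneg_right ?_ (by positivity)
      have h1 : ((perturbedNbr plaquetteSupp e).filter fun y => y ∈ X).card ≤ X.card :=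
        Finset.card_le_card fun y hy => (Finset.mem_filter.1 hy).2
      exact_mod_cast h1.trans (hp ▸ card_plaquetteEdges_le p)
    refine (Finset.sum_le_sum hX).trans ?_
    rw [Finset.sum_const, nsmul_eq_mul]
    calc ((((plaquetteSupp {e}).filter fun X => e ∈ X).card : ℕ) : ℝ) * (4 * Real.sqrt N)
        ≤ 2 * ((d : ℝ) - 1) * (4 * Real.sqrt N) := mul_le_mul_of_nonneg_right (hcard e) (by positivity)
      _ = 8 * ((d : ℝ) - 1) * Real.sqrt N := by ring

/-- **The Wilson direction is a member of the tier-2 ball** at every weight `t ≥ 0`: loads `(4(d−1)N, e^{t}·8(d−1)√N)`. -/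
theorem memBallZdS_wilsonDirection (hd : 1 ≤ d) {t : ℝ} (ht : 0 ≤ t) :
    MemBallZdS (4 * ((d : ℝ) - 1) * N) (exp t * (8 * ((d : ℝ) - 1) * Real.sqrt N)) t (wilsonDirection (d := d) (N := N)) := by
  simpa using (memBallZd_wilsonDirection (N := N) hd).memBallZdS ht

open Classical in
/-- Lipschitz witnesses supported on the plaquette link sets (the form whose total load is finite): `√N·𝟙[X is a plaquette set]·𝟙[y ∈ X]`. -/
theorem isLipBound_wilsonDirection_supp (X : Finset (ZdEdge d)) :
    IsLipBound suFrobDist (wilsonDirection (d := d) (N := N) X)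
      fun y => if (∃ p : ZdPlaquette d, plaquetteEdges p = X) then (if y ∈ X then Real.sqrt N else 0) else 0 := by
  by_cases h : ∃ p : ZdPlaquette d, plaquetteEdges p = X
  · simpa only [if_pos h] using isLipBound_wilsonDirection (N := N) X
  · rw [wilsonDirection_of_not h]
    exact ⟨fun y => by rw [if_neg h], fun y σ τ _ => by rw [if_neg h, sub_self, abs_zero, zero_mul]⟩

open Classical in
/-- **The total Lipschitz load of the Wilson direction** through every link is `≤ 8(d−1)√N` (with the supported witnesses): the summand
vanishes off the `≤ 2(d−1)` plaquette link sets through `e`, each carrying `≤ 4` links of weight `√N`. -/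
theorem lipLoad_wilsonDirection (hd : 1 ≤ d) (e : ZdEdge d) :
    (Summable fun X : Finset (ZdEdge d) => (if e ∈ X then ∑ y ∈ X,
        (if (∃ p : ZdPlaquette d, plaquetteEdges p = X) then (if y ∈ X then Real.sqrt (N : ℝ) else 0) else 0) else 0)) ∧
      ∑' X : Finset (ZdEdge d), (if e ∈ X then ∑ y ∈ X,
        (if (∃ p : ZdPlaquette d, plaquetteEdges p = X) then (if y ∈ X then Real.sqrt (N : ℝ) else 0) else 0) else 0) ≤
        8 * ((d : ℝ) - 1) * Real.sqrt N := by
  set S : Finset (Finset (ZdEdge d)) := (plaquetteSupp {e}).filter fun X => e ∈ X with hS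
  set g : Finset (ZdEdge d) → ℝ := fun X => if e ∈ X then ∑ y ∈ X,
      (if (∃ p : ZdPlaquette d, plaquetteEdges p = X) then (if y ∈ X then Real.sqrt (N : ℝ) else 0) else 0) else 0 with hg
  have hzero : ∀ X ∉ S, g X = 0 := by
    intro X hX
    by_cases heX : e ∈ X
    · have hnp : ¬ ∃ p : ZdPlaquette d, plaquetteEdges p = X := by
        rintro ⟨p, hp⟩
        refine hX (Finset.mem_filter.2 ⟨Finset.mem_image.2 ⟨p, mem_plaquettesTouching_iff.2 ⟨e, ?_⟩, hp⟩, heX⟩)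
        rw [hp]; exact Finset.mem_inter.2 ⟨heX, Finset.mem_singleton_self e⟩
      simp only [hg, if_pos heX, if_neg hnp, Finset.sum_const_zero]
    · simp only [hg, if_neg heX]
  have hsum : Summable g := summable_of_ne_finset_zero hzero
  refine ⟨hsum, ?_⟩
  rw [tsum_eq_sum hzero]
  have hX : ∀ X ∈ S, g X ≤ 4 * Real.sqrt N := by
    intro X hXm
    obtain ⟨p, -, hp⟩ := Finset.mem_image.1 (Finset.mem_filter.1 hXm).1
    simp only [hg, if_pos (Finset.mem_filter.1 hXm).2, if_pos (show ∃ q : ZdPlaquette d, plaquetteEdges q = X from ⟨p, hp⟩)]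
    rw [Finset.sum_ite_of_true (fun y hy => hy), Finset.sum_const, nsmul_eq_mul]
    exact mul_le_mul_of_nonneg_right (by exact_mod_cast (hp ▸ card_plaquetteEdges_le p)) (Real.sqrt_nonneg _)
  refine (Finset.sum_le_sum hX).trans ?_
  rw [Finset.sum_const, nsmul_eq_mul]
  have hcard : ((S.card : ℕ) : ℝ) ≤ 2 * ((d : ℝ) - 1) := by
    calc ((S.card : ℕ) : ℝ) ≤ ((2 * (d - 1) : ℕ) : ℝ) := by exact_mod_cast card_plaquetteSupp_singleton_le (d := d) e
      _ = 2 * ((d : ℝ) - 1) := by push_cast [Nat.cast_sub hd]; ring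
  calc ((S.card : ℕ) : ℝ) * (4 * Real.sqrt N) ≤ 2 * ((d : ℝ) - 1) * (4 * Real.sqrt N) :=
        mul_le_mul_of_nonneg_right hcard (by positivity)
    _ = 8 * ((d : ℝ) - 1) * Real.sqrt N := by ring

/-! ### Shifting the coupling is moving along the Wilson direction -/

section Identity

variable {W : Potential (ZdEdge d) (Matrix.specialUnitaryGroup (Fin N) ℂ)} {B : Finset (ZdEdge d) → ℝ}

/-- The Wilson direction's volume sum is the boundary Wilson action: `Σ'_{X ∩ Λ ≠ ∅} wilsonDirection_X = S_Λ`. -/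
theorem tsum_wilsonDirection_eq_wilsonBoundaryAction (Λ : Finset (ZdEdge d)) (U : LGConfig d (Matrix.specialUnitaryGroup (Fin N) ℂ)) :
    ∑' X : Finset (ZdEdge d), (if (X ∩ Λ).Nonempty then wilsonDirection (N := N) X U else 0) =
      wilsonBoundaryAction (fundamentalRep (Fin N)) Λ U := by
  classical
  rw [tsum_ite_eq_hamiltonianIn isSupportedBy_wilsonDirection Λ U]
  unfold hamiltonianIn wilsonBoundaryAction plaquetteSupp
  rw [Finset.filter_true_of_mem (fun A hA => by
    obtain ⟨p, hp, rfl⟩ := Finset.mem_image.1 hA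
    exact mem_plaquettesTouching_iff.1 hp)]
  rw [Finset.sum_image fun p _ q _ h => plaquetteEdges_injective h]
  exact Finset.sum_congr rfl fun p _ => wilsonDirection_plaquetteEdges p U

/-- **The energy identity**: `perturbedEnergyS β (W + κ·wilsonDirection) Λ = perturbedEnergyS (β + κ) W Λ` (link-summable `W`). -/
theorem perturbedEnergyS_add_smul_wilsonDirection (hW : IsLinkSummable W B) (β κ : ℝ) (Λ : Finset (ZdEdge d)) :
    perturbedEnergyS (fundamentalRep (Fin N)) β (W + κ • wilsonDirection) Λ =
      perturbedEnergyS (fundamentalRep (Fin N)) (β + κ) W Λ := by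
  classical
  haveI : Nonempty (LGConfig d (Matrix.specialUnitaryGroup (Fin N) ℂ)) := ⟨fun _ => 1⟩
  funext U
  have hsW := hW.summable_term Λ U
  obtain ⟨BP, hBP⟩ := isLinkSummable_of_supportedBy (fun X => ⟨2 * (N : ℝ), abs_wilsonDirection_le (N := N) X⟩)
    (isSupportedBy_wilsonDirection (d := d) (N := N))
  have hsP := (hBP.smul κ).summable_term Λ U
  have hsplit : (fun X : Finset (ZdEdge d) =>
      if (X ∩ Λ).Nonempty then (W + κ • (wilsonDirection : Potential (ZdEdge d) (Matrix.specialUnitaryGroup (Fin N) ℂ))) X U else 0) =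
      fun X => (if (X ∩ Λ).Nonempty then W X U else 0) +
        (if (X ∩ Λ).Nonempty then (κ • (wilsonDirection : Potential (ZdEdge d) (Matrix.specialUnitaryGroup (Fin N) ℂ))) X U else 0) := by
    funext X; split_ifs <;> simp
  have hκ : ∑' X : Finset (ZdEdge d), (if (X ∩ Λ).Nonempty then (κ • wilsonDirection (N := N)) X U else 0) =
      κ * wilsonBoundaryAction (fundamentalRep (Fin N)) Λ U := by
    rw [← tsum_wilsonDirection_eq_wilsonBoundaryAction Λ U, ← tsum_mul_left]
    exact tsum_congr fun X => by split_ifs <;> simp [Pi.smul_apply, smul_eq_mul]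
  unfold perturbedEnergyS
  rw [hsplit, hsW.tsum_add hsP, hκ]
  ring

/-- **SHIFTING THE COUPLING IS MOVING ALONG THE WILSON DIRECTION**: `perturbedYMS β (W + κ·wilsonDirection) = perturbedYMS (β + κ) W`. -/
theorem perturbedYMS_add_smul_wilsonDirection (hW : IsLinkSummable W B) (β κ : ℝ) :
    perturbedYMS (d := d) (fundamentalRep (Fin N)) β (W + κ • wilsonDirection) = perturbedYMS (fundamentalRep (Fin N)) (β + κ) W := by
  funext Λ η
  simp only [perturbedYMS, perturbedEnergyS_add_smul_wilsonDirection hW]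

/-- The DLR states at coupling `β + κ` are those of `W + κ·wilsonDirection` at coupling `β`. -/
theorem perturbedGibbsMeasuresS_add_smul_wilsonDirection (hW : IsLinkSummable W B) (β κ : ℝ) :
    perturbedGibbsMeasuresS (d := d) (fundamentalRep (Fin N)) β (W + κ • wilsonDirection) =
      perturbedGibbsMeasuresS (fundamentalRep (Fin N)) (β + κ) W := by
  unfold perturbedGibbsMeasuresS
  rw [perturbedYMS_add_smul_wilsonDirection hW]

end Identity

/-! ### The state is `C¹` in the coupling, uniformly on the ball -/

section Coupling

variable {W : Potential (ZdEdge d) (Matrix.specialUnitaryGroup (Fin N) ℂ)}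

/-- ★ **THE STATE OF EVERY MEMBER OF THE WEIGHTED BALL IS `C¹` IN THE COUPLING, with the fluctuation–response formula.**  Member
`W ∈ MemBallZdS a Λ t` (`t > 0`), coupling scale `κ` (the line is `s ↦` coupling `Nβ + sκ`), `s₀ > 0`, pair door `ρ' < 1` at the loads
`(a', Λ', t)` with `a + s₀|κ|·4(d−1)N ≤ a'`, `Λ + s₀|κ|·e^{t}8(d−1)√N ≤ Λ'`; `ν(s) ∈ 𝒢(perturbedYMS (Nβ + sκ) W)` ANY selection on `|s| ≤ s₀`;
`F` bounded measurable local with Frobenius-Lipschitz vector `δ_F`.  Then (i) at every `|s| < s₀`,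
`HasDerivAt (s ↦ ∫ F dν(s)) (−Σ'_X cov_{ν(s)}(F, (κ·wilsonDirection)_X)) s` (`= −κ Σ_p cov(F, N − Re tr U_p)`), and (ii) `s ↦ ∫ F dν(s)` is
`ContDiffOn ℝ 1` on `(−s₀, s₀)`. -/
theorem hasDerivAt_integral_coupling_S (hd : 1 ≤ d) (hN : 1 ≤ N) {β b c v a' Λ' t : ℝ}
    (hc : 0 ≤ c) (hv : 0 ≤ v) (hb : |β| * (2 * ((d : ℝ) - 1)) ≤ b)
    (hP : ∀ B : Matrix (Fin N) (Fin N) ℂ, matrixOpNorm B ≤ b →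
      ∀ (ψ : Matrix.specialUnitaryGroup (Fin N) ℂ → ℝ) (M : ℝ), 0 ≤ M →
        (∀ x y, |ψ x - ψ y| ≤ M * suFrobDist x y) →
        Var[ψ; (haarProbability (Matrix.specialUnitaryGroup (Fin N) ℂ)).tilted
          fun g => (N : ℝ) * ((g : Matrix (Fin N) (Fin N) ℂ) * B).trace.re] ≤ c * M ^ 2)
    (hVB : ∀ B : Matrix (Fin N) (Fin N) ℂ, matrixOpNorm B ≤ b → ∀ Δ : Matrix (Fin N) (Fin N) ℂ,
      Var[fun g : Matrix.specialUnitaryGroup (Fin N) ℂ =>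
          (N : ℝ) * ((g : Matrix (Fin N) (Fin N) ℂ) * Δ).trace.re;
        (haarProbability (Matrix.specialUnitaryGroup (Fin N) ℂ)).tilted
          fun g => (N : ℝ) * ((g : Matrix (Fin N) (Fin N) ℂ) * B).trace.re] ≤ v * frobNorm Δ ^ 2)
    (ht : 0 < t) (hρ : 6 * ((d : ℝ) - 1) * |β| * (exp a' * exp t * Real.sqrt (c * v)) + exp (a' / 2) * Real.sqrt c * Λ' < 1)
    {a Λ s₀ κ : ℝ} (hW : MemBallZdS a Λ t W) (hs₀ : 0 < s₀)
    (ha' : a + s₀ * (|κ| * (4 * ((d : ℝ) - 1) * N)) ≤ a') (hΛ' : Λ + s₀ * (|κ| * (exp t * (8 * ((d : ℝ) - 1) * Real.sqrt N))) ≤ Λ')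
    {ν : ℝ → Measure (LGConfig d (Matrix.specialUnitaryGroup (Fin N) ℂ))}
    (hν : ∀ s ∈ Set.Icc (-s₀) s₀, ν s ∈ perturbedGibbsMeasuresS (d := d) (fundamentalRep (Fin N)) (N * β + s * κ) W)
    {F : LGConfig d (Matrix.specialUnitaryGroup (Fin N) ℂ) → ℝ} (hFm : Measurable F) {ΛF : Finset (ZdEdge d)}
    (hFdep : DependsOn F (↑ΛF : Set (ZdEdge d))) {MF : ℝ} (hMF : ∀ σ, |F σ| ≤ MF) {δF : ZdEdge d → ℝ}
    (hδF : IsLipBound suFrobDist F δF) :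
    (∀ s ∈ Set.Ioo (-s₀) s₀, HasDerivAt (fun s => ∫ U, F U ∂(ν s))
        (-(∑' X : Finset (ZdEdge d), cov[F, (κ • (wilsonDirection : Potential (ZdEdge d) (Matrix.specialUnitaryGroup (Fin N) ℂ))) X; ν s])) s) ∧
      ContDiffOn ℝ 1 (fun s => ∫ U, F U ∂(ν s)) (Set.Ioo (-s₀) s₀) := by
  classical
  obtain ⟨BW, hBW⟩ := hW.summable
  set P : Potential (ZdEdge d) (Matrix.specialUnitaryGroup (Fin N) ℂ) := wilsonDirection with hPdef
  have hV : MemBallZdS (|κ| * (4 * ((d : ℝ) - 1) * N)) (|κ| * (exp t * (8 * ((d : ℝ) - 1) * Real.sqrt N))) t (κ • P) :=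
    (memBallZdS_wilsonDirection (N := N) hd ht.le).smul κ
  have hd1 : (0 : ℝ) ≤ (d : ℝ) - 1 := by
    have : (1 : ℝ) ≤ d := by exact_mod_cast hd
    linarith
  have haV : 0 ≤ |κ| * (4 * ((d : ℝ) - 1) * N) := by positivity
  have hΛV : 0 ≤ |κ| * (exp t * (8 * ((d : ℝ) - 1) * Real.sqrt N)) := by positivity
  -- the line `W + s·(κ·P)` at coupling `Nβ` IS the member at coupling `Nβ + sκ`
  have hν' : ∀ s ∈ Set.Icc (-s₀) s₀, ν s ∈ perturbedGibbsMeasuresS (d := d) (fundamentalRep (Fin N)) (N * β) (W + s • (κ • P)) :=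
    fun s hs => by
      rw [smul_smul, hPdef, perturbedGibbsMeasuresS_add_smul_wilsonDirection hBW]; exact hν s hs
  -- Lipschitz witnesses of `κ·P` and their total load
  set lipV : Finset (ZdEdge d) → ZdEdge d → ℝ := fun X y =>
    |κ| * (if (∃ p : ZdPlaquette d, plaquetteEdges p = X) then (if y ∈ X then Real.sqrt N else 0) else 0) with hlipV
  have hlip : ∀ X, IsLipBound suFrobDist ((κ • P) X) (lipV X) := fun X => by
    have h := isLipBound_smul (isLipBound_wilsonDirection_supp (N := N) X) κ
    exact h
  have hload := fun e => lipLoad_wilsonDirection (N := N) hd e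
  have hfun : ∀ e : ZdEdge d, (fun X : Finset (ZdEdge d) => (if e ∈ X then ∑ y ∈ X, lipV X y else 0)) =
      fun X => |κ| * (if e ∈ X then ∑ y ∈ X,
        (if (∃ p : ZdPlaquette d, plaquetteEdges p = X) then (if y ∈ X then Real.sqrt (N : ℝ) else 0) else 0) else 0) := fun e => by
    funext X; simp only [hlipV, ← Finset.mul_sum]; split_ifs <;> simp
  have hLs : ∀ e, Summable fun X : Finset (ZdEdge d) => (if e ∈ X then ∑ y ∈ X, lipV X y else 0) := fun e => by
    rw [hfun e]; exact ((hload e).1).mul_left |κ|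
  have hL : ∀ e, ∑' X : Finset (ZdEdge d), (if e ∈ X then ∑ y ∈ X, lipV X y else 0) ≤ |κ| * (8 * ((d : ℝ) - 1) * Real.sqrt N) :=
    fun e => by
      rw [hfun e, tsum_mul_left]
      exact mul_le_mul_of_nonneg_left (hload e).2 (abs_nonneg κ)
  have key := hasDerivAt_and_continuousOn_direction_S hd hN hc hv hb hP hVB ht hρ hW hV haV hΛV hs₀ ha' hΛ' hlip hLs hL hν' hFm hFdep hMF hδF
  exact ⟨key.1, Summit.Ventures.YMGap.CouplingResponse.contDiffOn_one_of_hasDerivAt key.1 key.2.neg⟩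

end Coupling

/-! ### `SU(2)`, `ℤ⁴`, in the cell's units -/

/-- **`SU(2)`, `ℤ⁴` — THE STATE OF EVERY MEMBER OF THE WEIGHTED BALL IS `C¹` IN THE WILSON COUPLING `β_W`.**  `0 < t`, `0 < s₀`,
`6|β_W| e^{a'} e^{t} + e^{a'/2} √(2/3) Λ' < 1`, `W ∈ MemBallZdS a Λ t`, `a + 12 s₀ ≤ a'`, `Λ + 12√2 e^{t} s₀ ≤ Λ'` (bare coupling `β'_W/2`, direction
`½·wilsonDirection`): for every selection `ν(s) ∈ 𝒢_{β_W + s}(W)` on `|s| ≤ s₀` and every Lipschitz cylinder `F`: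
`d/ds ∫ F dν(s) = −Σ'_X cov_{ν(s)}(F, (½·wilsonDirection)_X)` at every `|s| < s₀`, and `s ↦ ∫ F dν(s)` is `ContDiffOn ℝ 1` on `(−s₀, s₀)`. -/
theorem su2_hasDerivAt_integral_coupling_dim4 {βW a' Λ' t a Λ s₀ : ℝ} (ht : 0 < t) (hs₀ : 0 < s₀)
    (hρ : 6 * |βW| * (exp a' * exp t) + exp (a' / 2) * Real.sqrt (2 / 3) * Λ' < 1)
    {W : Potential (ZdEdge 4) (Matrix.specialUnitaryGroup (Fin 2) ℂ)} (hW : MemBallZdS a Λ t W)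
    (ha' : a + 12 * s₀ ≤ a') (hΛ' : Λ + 12 * Real.sqrt 2 * exp t * s₀ ≤ Λ')
    {ν : ℝ → Measure (LGConfig 4 (Matrix.specialUnitaryGroup (Fin 2) ℂ))}
    (hν : ∀ s ∈ Set.Icc (-s₀) s₀, ν s ∈ perturbedGibbsMeasuresS (d := 4) (fundamentalRep (Fin 2)) (2 * ((βW + s) / 4)) W)
    {F : LGConfig 4 (Matrix.specialUnitaryGroup (Fin 2) ℂ) → ℝ} {ΛF : Finset (ZdEdge 4)} {KF : ℝ≥0}
    (hF : IsLipschitzCylinder (fundamentalRep (Fin 2)) F ΛF KF) :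
    (∀ s ∈ Set.Ioo (-s₀) s₀, HasDerivAt (fun s => ∫ U, F U ∂(ν s))
        (-(∑' X : Finset (ZdEdge 4), cov[F, (((1 : ℝ) / 2) • (wilsonDirection : Potential (ZdEdge 4) (Matrix.specialUnitaryGroup (Fin 2) ℂ))) X;
          ν s])) s) ∧
      ContDiffOn ℝ 1 (fun s => ∫ U, F U ∂(ν s)) (Set.Ioo (-s₀) s₀) := by
  have hc : (0 : ℝ) ≤ 2 / 3 := by norm_num
  have hP : ∀ B : Matrix (Fin 2) (Fin 2) ℂ, matrixOpNorm B ≤ |βW / 4| * (2 * (((4 : ℕ) : ℝ) - 1)) →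
      ∀ (ψ : Matrix.specialUnitaryGroup (Fin 2) ℂ → ℝ) (M : ℝ), 0 ≤ M →
        (∀ x y, |ψ x - ψ y| ≤ M * suFrobDist x y) →
        Var[ψ; (haarProbability (Matrix.specialUnitaryGroup (Fin 2) ℂ)).tilted
          fun g => ((2 : ℕ) : ℝ) * ((g : Matrix (Fin 2) (Fin 2) ℂ) * B).trace.re] ≤ 2 / 3 * M ^ 2 :=
    fun B hB ψ M hM hψ => oneLinkPoincareSUN_two_sharp _ B hB ψ M hM hψ
  have hVB := linVariance_of_poincare (N := 2) hP
  have hv : (0 : ℝ) ≤ 2 / 3 * ((2 : ℕ) : ℝ) ^ 2 := by norm_num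
  have hsq : Real.sqrt (2 / 3 * (2 / 3 * ((2 : ℕ) : ℝ) ^ 2)) = 4 / 3 := by
    rw [show (2 / 3 * (2 / 3 * ((2 : ℕ) : ℝ) ^ 2) : ℝ) = (4 / 3) ^ 2 by norm_num, Real.sqrt_sq (by norm_num)]
  have hρ' : 6 * (((4 : ℕ) : ℝ) - 1) * |βW / 4| * (exp a' * exp t * Real.sqrt (2 / 3 * (2 / 3 * ((2 : ℕ) : ℝ) ^ 2))) +
      exp (a' / 2) * Real.sqrt (2 / 3) * Λ' < 1 := by
    rw [hsq, abs_div, abs_of_pos (by norm_num : (0 : ℝ) < 4)]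
    have : 6 * (((4 : ℕ) : ℝ) - 1) * (|βW| / 4) * (exp a' * exp t * (4 / 3)) = 6 * |βW| * (exp a' * exp t) := by norm_num; ring
    rw [this]; exact hρ
  have hν' : ∀ s ∈ Set.Icc (-s₀) s₀, ν s ∈ perturbedGibbsMeasuresS (d := 4) (fundamentalRep (Fin 2)) ((2 : ℕ) * (βW / 4) + s * (1 / 2)) W :=
    fun s hs => by
      have h := hν s hs
      have he : (2 : ℝ) * ((βW + s) / 4) = ((2 : ℕ) : ℝ) * (βW / 4) + s * (1 / 2) := by push_cast; ring
      rwa [he] at h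
  have hA : ∀ a b : Matrix.specialUnitaryGroup (Fin 2) ℂ, dist (suEntries a) (suEntries b) ≤ 1 * suFrobDist a b :=
    fun a b => by rw [one_mul]; exact dist_suEntries_le_suFrobDist a b
  have h2 : Real.sqrt ((2 : ℕ) : ℝ) = Real.sqrt 2 := by norm_num
  have ha'' : a + s₀ * (|(1 : ℝ) / 2| * (4 * (((4 : ℕ) : ℝ) - 1) * ((2 : ℕ) : ℝ))) ≤ a' := by
    rw [abs_of_pos (by norm_num : (0 : ℝ) < 1 / 2)]; norm_num; linarith
  have hΛ'' : Λ + s₀ * (|(1 : ℝ) / 2| * (exp t * (8 * (((4 : ℕ) : ℝ) - 1) * Real.sqrt ((2 : ℕ) : ℝ)))) ≤ Λ' := by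
    rw [abs_of_pos (by norm_num : (0 : ℝ) < 1 / 2), h2]
    have : s₀ * (1 / 2 * (exp t * (8 * (((4 : ℕ) : ℝ) - 1) * Real.sqrt 2))) = 12 * Real.sqrt 2 * exp t * s₀ := by norm_num; ring
    rw [this]; exact hΛ'
  exact hasDerivAt_integral_coupling_S (N := 2) (d := 4) (by norm_num) (by norm_num) hc hv le_rfl hP hVB ht hρ' hW hs₀ ha'' hΛ'' hν'
    hF.measurable hF.dependsOn hF.abs_le (hF.isLipBound zero_le_one hA)

end Summit.Ventures.YMGap.RobustBall

end
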